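import Literature.AlgebraicGeometry.HodgeTheory.CyclicCoverReflectionMonodromy
import Mathlib.RingTheory.Polynomial.Cyclotomic.Roots
import HarnessLib

/-!
# The vanishing space of a cyclic reflection has dimension `p − 1` AUTOMATICALLY (`p` prime)

Family `hodge`, layer `Literature/AlgebraicGeometry/HodgeTheory`; a complement to
`CyclicCoverReflectionMonodromy` (Carlson–Toledo 1999 §6: for the `p`-cyclic covers of the plane the
local monodromy of a meridian is the covering automorphism `τ` on the "`(k−1)`-dimensional" vanishing
space `V_γ = ℚ[τ]·δ_γ` of an `A_{p−1}`-degeneration, on which `τ` has "the eigenvalues the `k`-th roots of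
unity `μ ≠ 1`"). The tree's hypothesis structure `CyclicReflectionSystem Γ B τ p` records BOTH
`sum_pow_apply_eq_zero : Σ_{i<p} τ^i δ = 0` (no invariants) AND `finrank_cyclicSpan : dim ℚ[τ]·δ = p − 1`.
This file PROVES that for `p` prime the second follows from the first and `δ ≠ 0`: `ℚ[τ]·δ` is a cyclic
`ℚ[x]`-module killed by the cyclotomic polynomial `Φ_p = 1 + x + ⋯ + x^{p−1}`, which is irreducible over `ℚ`,
so `ℚ[τ]·δ ≅ ℚ[x]/(Φ_p) = ℚ(ζ_p)` has dimension `p − 1` — so that the cited Picard–Lefschetz package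
`carlsonToledo1999_cyclicReflectionSystem` may be re-typed without that clause.

* `aeval_apply_mem_cyclicSpan` — `q(τ)δ ∈ ℚ[τ]·δ` for every polynomial `q`;
* `linearIndependent_pow_apply_of_sum_pow_apply_eq_zero` — `δ, τδ, …, τ^{p−2}δ` are linearly independent
  (`p` prime, `δ ≠ 0`, `Σ_{i<p} τ^i δ = 0`);
* `cyclicSpan_eq_span_pow_apply_lt` — they span `ℚ[τ]·δ` (Euclidean division by `Φ_p`);
* **`finrank_cyclicSpan_of_sum_pow_apply_eq_zero`** — `dim_ℚ ℚ[τ]·δ = p − 1`.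

Everything is proved; no definitions, no named facts. Written by the prover seat `hodge-nonav-prover-Bx` (g7).

## References

* [CarlsonToledo1999] J. A. Carlson, D. Toledo, Discriminant complements and kernels of monodromy
  representations, Duke Math. J. 97 (1999), §6 (held text p0013): the `(k−1)`-dimensional space of vanishing
  cycles of `x^k = uv`, on which `σ₀` acts with eigenvalues the non-trivial `k`-th roots of unity.
* [Washington1997] L. C. Washington, Introduction to Cyclotomic Fields, 2nd ed., Springer GTM 83 (1997),
  Ch. 2 (irreducibility of `Φ_p`, `[ℚ(ζ_p) : ℚ] = p − 1`).
-/

noncomputable section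

open Polynomial Module

namespace Literature.AlgebraicGeometry.HodgeTheory

section Algebra

variable {V : Type*} [AddCommGroup V] [Module ℚ V]

/-- `((τ : End) ^ i) x = (τ ^ i) x` (powers of the automorphism and of its underlying linear map agree).
[cite: CarlsonToledo1999, §6 (held text p0013)] -/
private theorem end_pow_apply (τ : V ≃ₗ[ℚ] V) (i : ℕ) (x : V) :
    ((τ : V →ₗ[ℚ] V) ^ i) x = (τ ^ i) x := by
  rw [Module.End.coe_pow, LinearEquiv.coe_pow]
  rfl

/-- **`q(τ)δ ∈ ℚ[τ]·δ`** for every polynomial `q ∈ ℚ[x]`. [cite: CarlsonToledo1999, §6 (held text p0013)] -/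
theorem aeval_apply_mem_cyclicSpan (τ : V ≃ₗ[ℚ] V) (δ : V) (q : ℚ[X]) :
    Polynomial.aeval (τ : V →ₗ[ℚ] V) q δ ∈ cyclicSpan τ δ := by
  rw [Polynomial.aeval_eq_sum_range, LinearMap.sum_apply]
  refine Submodule.sum_mem _ fun i _ => ?_
  rw [LinearMap.smul_apply, end_pow_apply]
  exact Submodule.smul_mem _ _ (pow_apply_mem_cyclicSpan τ δ i)

/-- `Φ_p(τ) δ = Σ_{i<p} τ^i δ` for `p` prime. [cite: Washington1997, Ch. 2] -/
theorem aeval_cyclotomic_apply {p : ℕ} (hp : p.Prime) (τ : V ≃ₗ[ℚ] V) (δ : V) :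
    Polynomial.aeval (τ : V →ₗ[ℚ] V) (Polynomial.cyclotomic p ℚ) δ = ∑ i ∈ Finset.range p, (τ ^ i) δ := by
  haveI := Fact.mk hp
  rw [Polynomial.cyclotomic_prime, map_sum, LinearMap.sum_apply]
  refine Finset.sum_congr rfl fun i _ => ?_
  rw [map_pow, Polynomial.aeval_X, end_pow_apply]

/-- Polynomials in `τ` applied to `δ` only depend on their residue modulo any polynomial killing `δ`:
`(a·Ψ + r)(τ)δ = r(τ)δ` when `Ψ(τ)δ = 0`. [cite: CarlsonToledo1999, §6 (held text p0013)] -/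
theorem aeval_add_mul_apply_of_aeval_apply_eq_zero (τ : V ≃ₗ[ℚ] V) (δ : V) {Ψ : ℚ[X]}
    (hΨ : Polynomial.aeval (τ : V →ₗ[ℚ] V) Ψ δ = 0) (a r : ℚ[X]) :
    Polynomial.aeval (τ : V →ₗ[ℚ] V) (a * Ψ + r) δ = Polynomial.aeval (τ : V →ₗ[ℚ] V) r δ := by
  rw [map_add, map_mul, LinearMap.add_apply, Module.End.mul_apply, hΨ, map_zero, zero_add]

/-- **`δ, τδ, …, τ^{p−2}δ` span `ℚ[τ]·δ`** when `Σ_{i<p} τ^i δ = 0` (`p` prime): reduce `x^j` modulo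
`Φ_p`, of degree `p − 1`. [cite: CarlsonToledo1999, §6 (held text p0013)] -/
theorem cyclicSpan_eq_span_pow_apply_lt {p : ℕ} (hp : p.Prime) (τ : V ≃ₗ[ℚ] V) (δ : V)
    (h : ∑ i ∈ Finset.range p, (τ ^ i) δ = 0) :
    cyclicSpan τ δ = Submodule.span ℚ (Set.range fun i : Fin (p - 1) => (τ ^ (i : ℕ)) δ) := by
  have hΨ : Polynomial.aeval (τ : V →ₗ[ℚ] V) (Polynomial.cyclotomic p ℚ) δ = 0 := by
    rw [aeval_cyclotomic_apply hp, h]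
  refine le_antisymm ?_ (Submodule.span_le.mpr ?_)
  · rw [cyclicSpan_def, Submodule.span_le]
    rintro _ ⟨j, rfl⟩
    -- `x^j = (x^j / Φ_p) Φ_p + x^j % Φ_p`
    have hdiv := EuclideanDomain.div_add_mod ((X : ℚ[X]) ^ j) (Polynomial.cyclotomic p ℚ)
    have hx : (τ ^ j) δ = Polynomial.aeval (τ : V →ₗ[ℚ] V) ((X : ℚ[X]) ^ j % Polynomial.cyclotomic p ℚ) δ := by
      rw [← aeval_add_mul_apply_of_aeval_apply_eq_zero τ δ hΨ ((X : ℚ[X]) ^ j / Polynomial.cyclotomic p ℚ),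
        mul_comm, hdiv, map_pow, Polynomial.aeval_X, end_pow_apply]
    change (τ ^ j) δ ∈ _
    rw [hx, Polynomial.aeval_eq_sum_range' (p := (X : ℚ[X]) ^ j % Polynomial.cyclotomic p ℚ)
      (n := p - 1) ?_, LinearMap.sum_apply]
    · refine Submodule.sum_mem _ fun i hi => ?_
      rw [LinearMap.smul_apply, end_pow_apply]
      exact Submodule.smul_mem _ _ (Submodule.subset_span ⟨⟨i, Finset.mem_range.mp hi⟩, rfl⟩)
    · have hne : (Polynomial.cyclotomic p ℚ).natDegree ≠ 0 := by
        rw [Polynomial.natDegree_cyclotomic, Nat.totient_prime hp]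
        have := hp.two_le
        omega
      have hlt := Polynomial.natDegree_mod_lt ((X : ℚ[X]) ^ j) hne
      rwa [Polynomial.natDegree_cyclotomic, Nat.totient_prime hp] at hlt
  · rintro _ ⟨i, rfl⟩
    exact pow_apply_mem_cyclicSpan τ δ i

/-- **`δ, τδ, …, τ^{p−2}δ` are linearly independent** for `p` prime, `δ ≠ 0` and `Σ_{i<p} τ^i δ = 0`: a
non-trivial relation is a non-zero polynomial `q` of degree `< p − 1` with `q(τ)δ = 0`; `Φ_p` being
irreducible of degree `p − 1`, `q` and `Φ_p` are coprime, `a q + b Φ_p = 1`, whence `δ = 0`.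
[cite: CarlsonToledo1999, §6 (held text p0013)] [cite: Washington1997, Ch. 2] -/
theorem linearIndependent_pow_apply_of_sum_pow_apply_eq_zero {p : ℕ} (hp : p.Prime) (τ : V ≃ₗ[ℚ] V)
    {δ : V} (hδ : δ ≠ 0) (h : ∑ i ∈ Finset.range p, (τ ^ i) δ = 0) :
    LinearIndependent ℚ fun i : Fin (p - 1) => (τ ^ (i : ℕ)) δ := by
  have hΨ : Polynomial.aeval (τ : V →ₗ[ℚ] V) (Polynomial.cyclotomic p ℚ) δ = 0 := by
    rw [aeval_cyclotomic_apply hp, h]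
  by_contra hdep
  obtain ⟨g, hg, i₀, hi₀⟩ := Fintype.not_linearIndependent_iff.mp hdep
  -- the polynomial of the relation
  set q : ℚ[X] := ∑ i : Fin (p - 1), Polynomial.monomial (i : ℕ) (g i) with hq
  have hqδ : Polynomial.aeval (τ : V →ₗ[ℚ] V) q δ = 0 := by
    rw [hq, map_sum, LinearMap.sum_apply, ← hg]
    refine Finset.sum_congr rfl fun i _ => ?_
    rw [Polynomial.aeval_monomial, Module.End.mul_apply, end_pow_apply, Module.algebraMap_end_apply]
  have hcoeff : ∀ i : Fin (p - 1), q.coeff (i : ℕ) = g i := by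
    intro i
    rw [hq, Polynomial.finsetSum_coeff, Finset.sum_eq_single i]
    · exact Polynomial.coeff_monomial_same _ _
    · intro j _ hji
      rw [Polynomial.coeff_monomial, if_neg (fun hij => hji (Fin.ext hij))]
    · intro hi; exact absurd (Finset.mem_univ i) hi
  have hq0 : q ≠ 0 := fun h0 => hi₀ (by rw [← hcoeff i₀, h0, Polynomial.coeff_zero])
  have hqdeg : q.natDegree < p - 1 := by
    have h2 : 2 ≤ p := hp.two_le
    rw [hq]
    refine lt_of_le_of_lt (Polynomial.natDegree_sum_le_of_forall_le _ _ (n := p - 2) fun i _ => ?_) (by omega)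
    exact (Polynomial.natDegree_monomial_le _).trans (by have := i.2; omega)
  -- `Φ_p` does not divide `q`
  have hndvd : ¬ Polynomial.cyclotomic p ℚ ∣ q := by
    intro hdvd
    have hle := Polynomial.natDegree_le_of_dvd hdvd hq0
    rw [Polynomial.natDegree_cyclotomic, Nat.totient_prime hp] at hle
    omega
  obtain ⟨a, b, hab⟩ := ((Polynomial.cyclotomic.irreducible_rat hp.pos).coprime_iff_not_dvd.mpr hndvd)
  -- evaluate `a Φ_p + b q = 1` at `τ`, apply to `δ`
  have h1 : Polynomial.aeval (τ : V →ₗ[ℚ] V) (a * Polynomial.cyclotomic p ℚ + b * q) δ = δ := by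
    rw [hab, map_one, Module.End.one_apply]
  rw [map_add, map_mul, map_mul, LinearMap.add_apply, Module.End.mul_apply, Module.End.mul_apply, hΨ, hqδ,
    map_zero, map_zero, add_zero] at h1
  exact hδ h1.symm

/-- **The vanishing space has dimension `p − 1`** (Carlson–Toledo §6: "`(k−1)`-dimensional"), as a
CONSEQUENCE of `δ ≠ 0` and `Σ_{i<p} τ^i δ = 0` for `p` prime: `dim_ℚ ℚ[τ]·δ = p − 1` — the clause
`finrank_cyclicSpan` of `CyclicReflectionSystem` is implied by its clauses `ne_zero` and
`sum_pow_apply_eq_zero`. [cite: CarlsonToledo1999, §6 (held text p0013)] [cite: Washington1997, Ch. 2] -/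
theorem finrank_cyclicSpan_of_sum_pow_apply_eq_zero {p : ℕ} (hp : p.Prime) (τ : V ≃ₗ[ℚ] V) {δ : V}
    (hδ : δ ≠ 0) (h : ∑ i ∈ Finset.range p, (τ ^ i) δ = 0) :
    Module.finrank ℚ (cyclicSpan τ δ) = p - 1 := by
  rw [cyclicSpan_eq_span_pow_apply_lt hp τ δ h,
    finrank_span_eq_card (linearIndependent_pow_apply_of_sum_pow_apply_eq_zero hp τ hδ h), Fintype.card_fin]

end Algebra

end Literature.AlgebraicGeometry.HodgeTheory

end
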